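import Mathlib.AlgebraicTopology.FundamentalGroupoid.FundamentalGroup
import Mathlib.Geometry.Manifold.Diffeomorph
import Mathlib.Geometry.Manifold.PoincareConjecture
import Literature.Topology.FourManifolds.Trisections
import Literature.Topology.FourManifolds.GroupTrisections
import HarnessLib

/-!
# From trisected 4-manifolds to kernel triples (Abrams–Gay–Kirby)

Trunk T-4MAN (Literature/Topology/FourManifolds); definition request `defn-groupTrisectionOf`
(route SmoothPoincare4/GroupTrisection, assembly v2).

Given a smooth 4-manifold `X` trisected by `S : Fin 3 → Set X` (`IsTrisection X g k S`,
`Trisections.lean`), a base point `x₀` on the central surface `F = ⋂ l, S l`, and a MARKING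
`μ : S_g ≃* π₁(F, x₀)` (`SurfaceGroup g` of `GroupTrisections.lean`, Mathlib `FundamentalGroup`), the
Abrams–Gay–Kirby kernel triple is `Kᵢ = μ⁻¹(ker(π₁(F, x₀) → π₁(Hᵢ, x₀)))`, where
`Hᵢ = S (i+1) ∩ S (i+2)` is the handlebody opposite to the sector `S i` and the map is induced by the
inclusion `F ⊆ Hᵢ` (Mathlib `FundamentalGroup.map`). This is `groupTrisectionOf` (well defined up to
`TrisectionKernels.Iso` in `μ`; the base point rides along). The four facts needed by the route's
assembly are recorded as named `Prop`s: (a) AGK p. 1540 (the map `𝒢`) / Thm. 5 (it IS a group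
trisection of `π₁ X`),
(b) AGK Thm. 5 (rigidity up to diffeomorphism), (c) stabilisation compatibility, (d) the standard
trisections of the round `S⁴`; and (appended, `wi-03928`) (e) AGK Thm. 5 surjectivity (`ℳ`), (f) AGK
Cor. 6 (SPC4 ⟺ all `(3k,k)`-trisections of `{1}` stably trivial); and (appended, `wi-04065`) (g) the
central surface is a non-empty closed genus-`g` surface, so a marking `(x₀, μ)` — the input of
(a)–(c) — exists (Gay–Kirby Def. 1; Hatcher §1.2), with the consumer corollary
`exists_isGroupTrisection_of_isBalancedTrisection`.

## Status of the named facts (read before consuming any of (a)–(e), (g))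

The predicate `Literature.Topology.FourManifolds.IsTrisection` / `IsBalancedTrisection` of `Trisections.lean`, over which
(a)–(e), (g) quantify, is **unsatisfiable** (`Literature.Topology.FourManifolds.TrisectionRefutation.not_isBalancedTrisection`,
`TrisectionsRefutation.lean`: its clause (ii) makes the sectors smoothly embedded manifolds *with
boundary*, which cannot meet three at a time along the non-empty central surface, whereas
Gay–Kirby's sectors have corners along `F`).  Consequently (`TrisectionFunctorProofs.lean`):
(a) `isGroupTrisection_groupTrisectionOf`, (b) `diffeomorph_of_iso_groupTrisectionOf`,
(c) `exists_stabilized_trisection`, (g) `exists_marking_centralSurface` hold VACUOUSLY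
(`…_holds`), while the existential facts (d) `sphere_trisections` and
(e) `exists_trisected_of_isGroupTrisection` are FALSE as stated (`Literature.Topology.FourManifolds.not_sphere_trisections`,
`Literature.Topology.FourManifolds.not_exists_trisected_of_isGroupTrisection`); none of them carries the printed mathematics,
and a hypothesis `(h : sphere_trisections)` is contradictory.  **Verdict clean-up 2026-08-15
(REFUTED ⇒ retired from the fact debt):** (d) and (e) are now `@[deprecated]` (statements kept
verbatim, only because the refuting theorems — and, for (d), the route file
`Summits/SmoothPoincare4/SmoothPoincare4/Theses/GroupTrisection.lean`, items `Assembly`/`Assembly2`,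
hypothesis `h₅` — still name them); their docstrings point to the refutations and to the corrected
statements (d′) `Literature.Topology.FourManifolds.sphere_gkTrisections` and
(e′) `Literature.Topology.FourManifolds.exists_gkTrisected_of_isGroupTrisection`; never take either as a hypothesis in new
code.  The faithful versions are the facts
(a′)–(e′), (g′) of `TrisectionFunctorGK.lean`, verbatim over the corrected predicate
`Literature.Topology.FourManifolds.IsBalancedGKTrisection` (sectors with corners along the central surface; `Trisections.lean`);
in particular (d) is corrected as `Literature.Topology.FourManifolds.sphere_gkTrisections` (d′), which is reduced to the
stabilisation fact (c′) `Literature.Topology.FourManifolds.exists_stabilized_gkTrisection` alone by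
`Literature.Topology.FourManifolds.sphere_gkTrisections_of_stabilization` (`SphereTrisectionsSectors.lean`), Gay–Kirby's
genus-`0` trisection of `S⁴ ⊂ ℂ × ℝ³` into the sectors `2πj/3 ≤ θ ≤ 2π(j+1)/3` (§2, first
example) being fully formalised in `SphereTrisections.lean`, `SphereTrisectionsHandlebodies.lean`,
`SphereTrisectionsSectors.lean` (`Literature.Topology.FourManifolds.sphereSector_isBalancedGKTrisection_holds`).  (f) mentions no
trisected manifold and is unaffected.  The definitions and statements below are kept unchanged
(they are imported by `TrisectionFunctorGK.lean`, `TrisectionFunctorProofs.lean` and a route file).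

## Sources

* A. Abrams, D. Gay, R. Kirby, *Group trisections and smooth 4-manifolds*, Geom. Topol. 22 (2018)
  1537–1545 (no section numbers in print): Def. 1 (group trisection) and trisected isomorphism,
  p. 1538; Def. 2 (connected sum), p. 1539; Def. 3 (stabilisation) and Def. 4 (trisection of a
  4-manifold), p. 1540; the map `𝒢` from trisected 4-manifolds to trisected groups, p. 1540; Thm. 5
  (the map `ℳ`, `ℳ ∘ 𝒢 = id` up to trisected diffeomorphism, `𝒢 ∘ ℳ = id` up to trisected
  isomorphism, hence the bijection modulo isomorphism and stabilisation), p. 1541; Cor. 6 (SPC4 ⟺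
  every `(3k, k)`-trisection of `{1}` is stably equivalent to the trivial one), p. 1541.
  (Regrounded 2026-08-14 against the published PDF: earlier drafts of this file cited these as
  "Thm. 3" and "Cor. 4"; the printed numbers are Thm. 5 and Cor. 6.)
* D. Gay, R. Kirby, *Trisecting 4-manifolds*, Geom. Topol. 20 (2016) 3097–3132: Def. 1 and Thm. 4
  (existence), p. 3098; Def. 8 (stabilisation), p. 3099; Def. 9 and Figure 3 (the genus-3 trisection
  of `S⁴`; stabilisation = connected sum with it), p. 3100; Lemma 10, p. 3100; Thm. 11 (uniqueness up
  to stabilisation), p. 3101.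
* A. Hatcher, *Algebraic Topology*, CUP 2002, §1.2 (p. 51: `π₁` of the closed orientable surface
  of genus `g`), Prop. 1.26.
-/

noncomputable section

open Set
open scoped Manifold ContDiff

namespace Literature.Topology.FourManifolds

universe u

variable {X : Type u} [TopologicalSpace X] [ChartedSpace (EuclideanSpace ℝ (Fin 4)) X]
  {g : ℕ} {k : Fin 3 → ℕ} {S : Fin 3 → Set X}

/-- The central surface `F = S 0 ∩ S 1 ∩ S 2` of a trisection, as a subspace.
[Gay–Kirby 2016, Def. 1] [cite: GayKirby2016, Def. 1] -/
abbrev centralSurface (S : Fin 3 → Set X) : Type u := ↥(⋂ l, S l)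

/-- The handlebody `Hᵢ = S (i+1) ∩ S (i+2)` opposite to the sector `S i`, as a subspace.
[Gay–Kirby 2016, Def. 1; Abrams–Gay–Kirby 2018, §1 (`H_ij = X_i ∩ X_j`)] [cite: AbramsGayKirby2018, §1] -/
abbrev handlebodyOpp (S : Fin 3 → Set X) (i : Fin 3) : Type u := ↥(S (i + 1) ∩ S (i + 2))

omit [TopologicalSpace X] [ChartedSpace (EuclideanSpace ℝ (Fin 4)) X] in
/-- The central surface lies in every handlebody. [Gay–Kirby 2016, Def. 1] [folklore] -/
theorem iInter_subset_inter (S : Fin 3 → Set X) (i : Fin 3) : (⋂ l, S l) ⊆ S (i + 1) ∩ S (i + 2) :=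
  fun _ hx => ⟨mem_iInter.1 hx _, mem_iInter.1 hx _⟩

/-- The inclusion `F ↪ Hᵢ` as a continuous map. [Abrams–Gay–Kirby 2018, §1] [folklore] -/
def centralInclusion (S : Fin 3 → Set X) (i : Fin 3) : C(centralSurface S, handlebodyOpp S i) :=
  ⟨Set.inclusion (iInter_subset_inter S i), continuous_inclusion (iInter_subset_inter S i)⟩

/-- **The Abrams–Gay–Kirby kernel triple of a trisected 4-manifold**: for a trisection
`h : IsTrisection X g k S`, a base point `x₀ ∈ F = ⋂ S l` and a marking `μ : S_g ≃* π₁(F, x₀)`,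
`groupTrisectionOf h x₀ μ i = μ⁻¹ (ker (π₁(F, x₀) → π₁(Hᵢ, x₀)))` with `Hᵢ = S (i+1) ∩ S (i+2)`
and the map induced by inclusion. (Depends on `μ` only up to `TrisectionKernels.Iso`; the
hypothesis `h` is carried for meaning and is not used in the formula.) [Abrams–Gay–Kirby 2018, §1
(`S_g ↠ π₁(H_ij) ≅ F_g`, kernels `Kᵢ`)] [cite: AbramsGayKirby2018, §1] -/
def groupTrisectionOf (_h : IsTrisection X g k S) (x₀ : centralSurface S)
    (μ : SurfaceGroup g ≃* FundamentalGroup (centralSurface S) x₀) : TrisectionKernels g :=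
  fun i => ((FundamentalGroup.map (centralInclusion S i) x₀).ker).comap μ.toMonoidHom

/-- Unfolding: `γ ∈ Kᵢ` iff the loop `μ γ` dies in `π₁(Hᵢ)`. [Abrams–Gay–Kirby 2018, §1] [folklore] -/
theorem mem_groupTrisectionOf_iff (h : IsTrisection X g k S) (x₀ : centralSurface S)
    (μ : SurfaceGroup g ≃* FundamentalGroup (centralSurface S) x₀) (i : Fin 3) (γ : SurfaceGroup g) :
    γ ∈ groupTrisectionOf h x₀ μ i ↔ FundamentalGroup.map (centralInclusion S i) x₀ (μ γ) = 1 :=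
  Iff.rfl

/-- Changing the marking by an automorphism of `S_g` changes the kernel triple by an isomorphism.
[Abrams–Gay–Kirby 2018, §2 (isomorphism of group trisections)] [folklore] -/
theorem groupTrisectionOf_iso_of_marking (h : IsTrisection X g k S) (x₀ : centralSurface S)
    (μ : SurfaceGroup g ≃* FundamentalGroup (centralSurface S) x₀) (α : SurfaceGroup g ≃* SurfaceGroup g) :
    TrisectionKernels.Iso (groupTrisectionOf h x₀ (α.trans μ)) (groupTrisectionOf h x₀ μ) := by
  refine ⟨α, fun i => ?_⟩
  ext γ
  simp only [groupTrisectionOf, Subgroup.mem_map, Subgroup.mem_comap, MulEquiv.coe_toMonoidHom,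
    MulEquiv.trans_apply]
  constructor
  · rintro ⟨δ, hδ, rfl⟩
    exact hδ
  · intro hγ
    exact ⟨α.symm γ, by simpa using hγ, by simp⟩

/-! ### Named facts for the assembly -/

/-- **(a) Abrams–Gay–Kirby, p. 1540 (the map `𝒢`) and Thm. 5.** For a balanced `(g, k)`-trisection of a closed connected
oriented smooth 4-manifold, the kernel triple is a `(g, k)` group trisection of `π₁(X, x₀)`
(the `Hᵢ` are genus-`g` handlebodies so `S_g ↠ π₁ Hᵢ ≅ F_g`; pairwise van Kampen gives
`π₁(X_i) ≅ F_k`; the triple pushout is `π₁ X`). Print, p. 1540: "There is an obvious map from the set of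
parametrized based trisected 4-manifolds to the set of trisected groups, which we will call `𝒢`; the
groups are the fundamental groups of the `Xᵢ` and their intersections".  STATUS: vacuously true
(`isGroupTrisection_groupTrisectionOf_holds`, `TrisectionFunctorProofs.lean`) because
`IsBalancedTrisection` is unsatisfiable; faithful version: (a′)
`isGroupTrisection_groupGKTrisectionOf` (`TrisectionFunctorGK.lean`). [Abrams–Gay–Kirby 2018,
p. 1540 and Thm. 5, p. 1541] [cite: AbramsGayKirby2018, Thm. 5 (p. 1541) and p. 1540 (the map 𝒢)] -/
def isGroupTrisection_groupTrisectionOf : Prop :=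
  ∀ (X : Type u) [TopologicalSpace X] [T2Space X] [SecondCountableTopology X]
    [ChartedSpace (EuclideanSpace ℝ (Fin 4)) X] [IsManifold (𝓡 4) ∞ X] [CompactSpace X]
    [ConnectedSpace X] (_ : SmoothOrientation (𝓡 4) X) (g k : ℕ) (S : Fin 3 → Set X)
    (h : IsBalancedTrisection X g k S) (x₀ : centralSurface S)
    (μ : SurfaceGroup g ≃* FundamentalGroup (centralSurface S) x₀),
    IsGroupTrisection g k (FundamentalGroup X (x₀ : X)) (groupTrisectionOf h x₀ μ)

/-- **(b) Abrams–Gay–Kirby, Thm. 5 (rigidity).** Two closed connected oriented smooth 4-manifolds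
carrying balanced trisections with isomorphic kernel triples are diffeomorphic (the kernel triple
determines the trisection up to diffeomorphism, by Laudenbach–Poénaru).
Print, Thm. 5, p. 1541: "`ℳ ∘ 𝒢` is the identity up to orientation-preserving trisected
diffeomorphism". NB the Lean `TrisectionKernels.Iso` allows all of `Aut(S_g)` (orientation-reversing
included), slightly coarser than the printed orientation-preserving trisected isomorphism (p. 1538);
the conclusion here is an unoriented diffeomorphism.  STATUS: vacuously true
(`diffeomorph_of_iso_groupTrisectionOf_holds`, `TrisectionFunctorProofs.lean`); faithful version:
(b′) `diffeomorph_of_iso_groupGKTrisectionOf` (`TrisectionFunctorGK.lean`).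
[Abrams–Gay–Kirby 2018, Thm. 5, p. 1541] [cite: AbramsGayKirby2018, Thm. 5 (p. 1541)] -/
def diffeomorph_of_iso_groupTrisectionOf : Prop :=
  ∀ (X : Type u) [TopologicalSpace X] [T2Space X] [SecondCountableTopology X]
    [ChartedSpace (EuclideanSpace ℝ (Fin 4)) X] [IsManifold (𝓡 4) ∞ X] [CompactSpace X]
    [ConnectedSpace X] (_ : SmoothOrientation (𝓡 4) X)
    (X' : Type u) [TopologicalSpace X'] [T2Space X'] [SecondCountableTopology X']
    [ChartedSpace (EuclideanSpace ℝ (Fin 4)) X'] [IsManifold (𝓡 4) ∞ X'] [CompactSpace X']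
    [ConnectedSpace X'] (_ : SmoothOrientation (𝓡 4) X')
    (g k : ℕ) (S : Fin 3 → Set X) (S' : Fin 3 → Set X')
    (h : IsBalancedTrisection X g k S) (h' : IsBalancedTrisection X' g k S')
    (x₀ : centralSurface S) (x₀' : centralSurface S')
    (μ : SurfaceGroup g ≃* FundamentalGroup (centralSurface S) x₀)
    (μ' : SurfaceGroup g ≃* FundamentalGroup (centralSurface S') x₀'),
    TrisectionKernels.Iso (groupTrisectionOf h x₀ μ) (groupTrisectionOf h' x₀' μ') →
      Nonempty (X ≃ₘ⟮𝓡 4, 𝓡 4⟯ X')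

/-- **(c) Stabilisation compatibility (Gay–Kirby 2016, §1; Abrams–Gay–Kirby 2018, §2).** A balanced
`(g, k)`-trisected closed connected oriented 4-manifold admits a balanced `(g+3, k+1)`-trisection
(the Gay–Kirby stabilisation) whose kernel triple is isomorphic to the algebraic stabilisation
`TrisectionKernels.stabilize` of the original one. [Gay–Kirby 2016, Def. 8 (p. 3099) and Lemma 10
(p. 3100); Abrams–Gay–Kirby 2018, Def. 3 (p. 1540) and Thm. 5 (p. 1541: "connected sums of group
trisections map to connected sums of 4-manifold trisections")]  STATUS: vacuously true
(`exists_stabilized_trisection_holds`, `TrisectionFunctorProofs.lean`); faithful version: (c′)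
`exists_stabilized_gkTrisection` (`TrisectionFunctorGK.lean`, not proved in the tree).
[cite: AbramsGayKirby2018, Def. 3 (p. 1540) and Thm. 5 (p. 1541)] -/
def exists_stabilized_trisection : Prop :=
  ∀ (X : Type u) [TopologicalSpace X] [T2Space X] [SecondCountableTopology X]
    [ChartedSpace (EuclideanSpace ℝ (Fin 4)) X] [IsManifold (𝓡 4) ∞ X] [CompactSpace X]
    [ConnectedSpace X] (_ : SmoothOrientation (𝓡 4) X) (g k : ℕ) (S : Fin 3 → Set X)
    (h : IsBalancedTrisection X g k S) (x₀ : centralSurface S)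
    (μ : SurfaceGroup g ≃* FundamentalGroup (centralSurface S) x₀),
    ∃ (S' : Fin 3 → Set X) (h' : IsBalancedTrisection X (g + 3) (k + 1) S')
      (x₀' : centralSurface S') (μ' : SurfaceGroup (g + 3) ≃* FundamentalGroup (centralSurface S') x₀'),
      TrisectionKernels.Iso (groupTrisectionOf h' x₀' μ') (groupTrisectionOf h x₀ μ).stabilize

/-- **Deprecated** (verdict clean-up 2026-08-15) — **(d) is REFUTED as stated; never use
`(h : sphere_trisections)` as a hypothesis (it proves `False`).**  Refuting theorem:
`Literature.Topology.FourManifolds.not_sphere_trisections : ¬ sphere_trisections` (`TrisectionFunctorProofs.lean`): already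
for `m = 0` the statement asks for an `IsBalancedTrisection` of the round `S⁴`, and the vendored
predicate `IsTrisection` / `IsBalancedTrisection` (`Trisections.lean`) is unsatisfiable
(`Literature.Topology.FourManifolds.TrisectionRefutation.not_isBalancedTrisection`, `TrisectionsRefutation.lean`: its clause
(ii) makes the sectors smoothly embedded manifolds *with boundary*, which cannot meet three at a
time along the non-empty central surface, whereas Gay–Kirby's sectors
`X_j = {(re^{iθ}, x₃, x₄, x₅) | 2πj/3 ≤ θ ≤ 2π(j+1)/3}` of `S⁴ ⊂ ℂ × ℝ³` (§2) have corners along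
`F`).  *What is wrong:* the rendering, not the source — an existential over an unsatisfiable
predicate.  *Corrected statement:* (d′) `Literature.Topology.FourManifolds.sphere_gkTrisections`
(`TrisectionFunctorGK.lean`, downstream of this file: this statement verbatim with
`IsBalancedTrisection ↦ IsBalancedGKTrisection` and `groupTrisectionOf ↦ groupGKTrisectionOf`,
i.e. sectors with corners along the central surface), which is reduced to the stabilisation fact
(c′) `Literature.Topology.FourManifolds.exists_stabilized_gkTrisection` by
`Literature.Topology.FourManifolds.sphere_gkTrisections_of_stabilization` (`SphereTrisectionsSectors.lean`), Gay–Kirby's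
genus-`0` trisection of `S⁴` (§2, first example) being proved there
(`Literature.Topology.FourManifolds.sphereSector_isBalancedGKTrisection_holds`).  Kept, statement unchanged, only because its
refutation and the route file `Summits/SmoothPoincare4/SmoothPoincare4/Theses/GroupTrisection.lean`
(items `Assembly`, `Assembly2`, hypothesis `h₅`, flagged there for restatement over (d′)) still
name it.
*Original content* — **(d) The standard trisections of the round `S⁴` (Gay–Kirby 2016, §1)**, read
over `IsBalancedTrisection`: for every `m`, the unit sphere `S⁴ ⊆ ℝ⁵` (Mathlib's smooth structure)
admits a balanced `(3 + 3m, 1 + m)`-trisection whose kernel triple is isomorphic to the `m`-fold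
algebraic stabilisation `s4Kernels.stabilizeIter m` of the genus-`3` `S⁴` triple (Gay–Kirby's
genus-`3n` trisections of `S⁴` are the stabilisations of the genus-`0` one; indexing chosen to
match `TrisectionKernels.stabilizeIter` without casts). [Gay–Kirby 2016, Def. 8–9 and Figure 3,
pp. 3099–3100 (the genus-`3` trisection of `S⁴`; stabilisation = connected sum with it);
Abrams–Gay–Kirby 2018, Thm. 5, p. 1541 ("the standard `(3, 1)`-trisection of `{1}` maps to the
standard `(3, 1)`-trisection of `S⁴`")]
[cite: GayKirby2016, Def. 9 and Fig. 3 (p. 3100) — mis-rendered over the unsatisfiable IsBalancedTrisection; refuted in tree (not_sphere_trisections); corrected as sphere_gkTrisections] -/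
@[deprecated "REFUTED as stated (an ∃ over the unsatisfiable `IsBalancedTrisection`: `Literature.Topology.FourManifolds.not_sphere_trisections`, TrisectionFunctorProofs.lean) — use the corrected fact `Literature.Topology.FourManifolds.sphere_gkTrisections` of TrisectionFunctorGK.lean" (since := "2026-08-15")]
def sphere_trisections : Prop :=
  ∀ m : ℕ, ∃ (S : Fin 3 → Set (Metric.sphere (0 : EuclideanSpace ℝ (Fin 5)) 1))
    (h : IsBalancedTrisection (Metric.sphere (0 : EuclideanSpace ℝ (Fin 5)) 1) (3 + 3 * m) (1 + m) S)
    (x₀ : centralSurface S)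
    (μ : SurfaceGroup (3 + 3 * m) ≃* FundamentalGroup (centralSurface S) x₀),
    TrisectionKernels.Iso (groupTrisectionOf h x₀ μ) (s4Kernels.stabilizeIter m)


/-! ### (e), (f): surjectivity of the functor and the SPC4 dictionary (Abrams–Gay–Kirby) -/

/-- **Deprecated** (verdict clean-up 2026-08-15) — **(e) is REFUTED as stated; never use
`(h : exists_trisected_of_isGroupTrisection)` as a hypothesis (it proves `False`).**  Refuting
theorem: `Literature.Topology.FourManifolds.not_exists_trisected_of_isGroupTrisection : ¬ exists_trisected_of_isGroupTrisection`
(`TrisectionFunctorProofs.lean`): applied to the `(0, 0)` trisection of the trivial group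
(`Literature.Topology.FourManifolds.trivialKernels_isGroupTrisection`) the statement would produce a closed oriented 4-manifold
carrying an `IsBalancedTrisection`, and there is none
(`Literature.Topology.FourManifolds.TrisectionRefutation.not_isBalancedTrisection`, `TrisectionsRefutation.lean`: the vendored
sectors are manifolds with boundary, Gay–Kirby's have corners along the central surface).  *What
is wrong:* the rendering, not the source — the conclusion asks for an inhabitant of an
unsatisfiable predicate.  *Corrected statement:* (e′)
`Literature.Topology.FourManifolds.exists_gkTrisected_of_isGroupTrisection` (`TrisectionFunctorGK.lean`, downstream of this
file: this statement verbatim with `IsBalancedTrisection ↦ IsBalancedGKTrisection` and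
`groupTrisectionOf ↦ groupGKTrisectionOf`); its genus-`0` instance is proved in
`TrisectionFunctorGKGenusZero.lean` (`exists_gkTrisected_of_isGroupTrisection_genusZero`).  Kept,
statement unchanged, only because its refutation still names it.
*Original content* — **(e) Abrams–Gay–Kirby, Thm. 5 (`ℳ`: group trisections → trisected
4-manifolds; `𝒢 ∘ ℳ = id` up to isomorphism)**, read over `IsBalancedTrisection`: every `(g, k)`
group trisection of a group `G` is isomorphic to the kernel triple `groupTrisectionOf` of a
balanced `(g, k)`-trisection of some closed, connected, oriented smooth 4-manifold (whose
fundamental group is then `G`, by (a)). Together with (b) this is AGK's bijection "trisected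
groups mod isomorphism ↔ trisected 4-manifolds mod diffeomorphism". [Abrams–Gay–Kirby 2018,
Thm. 5, p. 1541: "There exists a map `ℳ` from the set of trisected groups to the set of (based,
parametrized) trisected 4-manifolds such that `ℳ ∘ 𝒢` is the identity up to trisected
diffeomorphism and `𝒢 ∘ ℳ` is the identity up to trisected isomorphism."]
[cite: AbramsGayKirby2018, Thm. 5 (p. 1541) — mis-rendered over the unsatisfiable IsBalancedTrisection; refuted in tree (not_exists_trisected_of_isGroupTrisection); corrected as exists_gkTrisected_of_isGroupTrisection] -/
@[deprecated "REFUTED as stated (asks for an inhabitant of the unsatisfiable `IsBalancedTrisection`: `Literature.Topology.FourManifolds.not_exists_trisected_of_isGroupTrisection`, TrisectionFunctorProofs.lean) — use the corrected fact `Literature.Topology.FourManifolds.exists_gkTrisected_of_isGroupTrisection` of TrisectionFunctorGK.lean" (since := "2026-08-15")]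
def exists_trisected_of_isGroupTrisection : Prop :=
  ∀ (g k : ℕ) (G : Type u) [Group G] (K : TrisectionKernels g), IsGroupTrisection g k G K →
    ∃ (X : Type u) (_ : TopologicalSpace X) (_ : T2Space X) (_ : SecondCountableTopology X)
      (_ : ChartedSpace (EuclideanSpace ℝ (Fin 4)) X) (_ : IsManifold (𝓡 4) ∞ X)
      (_ : CompactSpace X) (_ : ConnectedSpace X) (_ : SmoothOrientation (𝓡 4) X)
      (S : Fin 3 → Set X) (h : IsBalancedTrisection X g k S) (x₀ : centralSurface S)
      (μ : SurfaceGroup g ≃* FundamentalGroup (centralSurface S) x₀),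
      TrisectionKernels.Iso (groupTrisectionOf h x₀ μ) K

/-- **(f) Abrams–Gay–Kirby, Cor. 6: SPC4 ⟺ every `(3k, k)`-trisection of the trivial group is stably
trivial.** The smooth 4-dimensional Poincaré conjecture — in Mathlib's wording, every closed smooth
4-manifold homotopy equivalent to `S⁴` is diffeomorphic to `S⁴`
(`ContinuousMap.HomotopyEquiv.NonemptyDiffeomorphSphere M 4`; this is literally the body of the
Problems-layer `SmoothPoincare4`, which Literature cannot import) — holds iff every `(3k, k)` group
trisection of the trivial group is stably equivalent to (a stabilisation of) the standard
trisection of `S⁴` (`TrisectionKernels.IsStablyTrivial`). Print, Cor. 6, p. 1541: "The smooth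
4-dimensional Poincaré conjecture is equivalent to the following statement: Every `(3k, k)`-trisection
of the trivial group is stably equivalent to the trivial trisection of the trivial group."
[Abrams–Gay–Kirby 2018, Cor. 6, p. 1541] [cite: AbramsGayKirby2018, Cor. 6 (p. 1541)] -/
def spc4_iff_forall_isStablyTrivial : Prop :=
  (∀ (M : Type u) [TopologicalSpace M] [T2Space M] [SecondCountableTopology M],
      ContinuousMap.HomotopyEquiv.NonemptyDiffeomorphSphere M 4) ↔
    ∀ (k : ℕ) (K : TrisectionKernels (3 * k)),
      IsGroupTrisection (3 * k) k (PUnit : Type u) K → K.IsStablyTrivial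

/-- One direction of (f) in the form the GroupTrisection route consumes: under AGK Cor. 6, stable
triviality of all trisections of the trivial group implies SPC4. [folklore] -/
theorem spc4_of_forall_isStablyTrivial (h : spc4_iff_forall_isStablyTrivial.{u})
    (hst : ∀ (k : ℕ) (K : TrisectionKernels (3 * k)),
      IsGroupTrisection (3 * k) k (PUnit : Type u) K → K.IsStablyTrivial)
    (M : Type u) [TopologicalSpace M] [T2Space M] [SecondCountableTopology M] :
    ContinuousMap.HomotopyEquiv.NonemptyDiffeomorphSphere M 4 :=
  h.2 hst M

/-! ### (g): the central surface is a marked genus-`g` surface (input `(x₀, μ)` of (a)–(c)) -/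

/-- **(g) The central surface of a balanced trisection is a non-empty closed genus-`g` surface, so a
marking exists.** For a balanced `(g, k)`-trisection `S` of a closed, connected, oriented smooth
4-manifold `X`, the central surface `F = ⋂ l, S l` has a point `x₀` and an isomorphism
`S_g ≃* π₁(F, x₀)` from the surface group `SurfaceGroup g = ⟨a₁, b₁, …, a_g, b_g ∣ ∏ᵢ [aᵢ, bᵢ]⟩`.
Print: by clause (iii) of `IsTrisection`, `F = h(∂H)` for a smooth embedding `h` of a compact
connected `3`-dimensional `1`-handlebody `H` with `g` `1`-handles; `H` is codimension `0` in the
oriented `X`, hence orientable, so `H ≅ ♮^g (S¹ × D²)` and `F ≅ ∂H ≅ Σ_g` is THE closed orientable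
genus-`g` surface (Gay–Kirby 2016, Def. 1: "`F_g = X₁ ∩ X₂ ∩ X₃` is a closed genus-`g` surface";
Abrams–Gay–Kirby 2018, §1: `S_g = π₁(F_g)`), which is non-empty with
`π₁(Σ_g, x₀) ≅ ⟨a₁, b₁, …, a_g, b_g ∣ ∏ᵢ [aᵢ, bᵢ]⟩` (Hatcher, *Algebraic Topology* (2002), §1.2,
p. 51, via Prop. 1.26 and the one-`0`-cell, `2g`-`1`-cell, one-`2`-cell CW structure). The
orientation hypothesis only excludes non-orientable handlebodies `H`; it is carried by all
consumers (a)–(c), whose inputs `(x₀, μ)` this fact supplies.  STATUS: vacuously true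
(`exists_marking_centralSurface_holds`, `TrisectionFunctorProofs.lean`); faithful version: (g′)
`exists_marking_centralSurface_of_gkTrisection` (`TrisectionFunctorGK.lean`).
[cite: GayKirby2016, Def. 1] [cite: Hatcher2002, §1.2 p. 51 and Prop. 1.26] -/
def exists_marking_centralSurface : Prop :=
  ∀ (X : Type u) [TopologicalSpace X] [T2Space X] [SecondCountableTopology X]
    [ChartedSpace (EuclideanSpace ℝ (Fin 4)) X] [IsManifold (𝓡 4) ∞ X] [CompactSpace X]
    [ConnectedSpace X] (_ : SmoothOrientation (𝓡 4) X) (g k : ℕ) (S : Fin 3 → Set X),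
    IsBalancedTrisection X g k S →
      ∃ x₀ : centralSurface S, Nonempty (SurfaceGroup g ≃* FundamentalGroup (centralSurface S) x₀)

/-- Consumer form of (g) + (a): under the two named facts, a balanced trisection of a closed
connected oriented smooth 4-manifold yields SOME base point, marking and `(g, k)` group trisection
of `π₁(X, x₀)` (the kernel triple `groupTrisectionOf`). [cite: AbramsGayKirby2018, Thm. 5 (p. 1541)] -/
theorem exists_isGroupTrisection_of_isBalancedTrisection
    (hg : exists_marking_centralSurface.{u}) (ha : isGroupTrisection_groupTrisectionOf.{u})
    (X : Type u) [TopologicalSpace X] [T2Space X] [SecondCountableTopology X]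
    [ChartedSpace (EuclideanSpace ℝ (Fin 4)) X] [IsManifold (𝓡 4) ∞ X] [CompactSpace X]
    [ConnectedSpace X] (o : SmoothOrientation (𝓡 4) X) (g k : ℕ) (S : Fin 3 → Set X)
    (h : IsBalancedTrisection X g k S) :
    ∃ (x₀ : centralSurface S) (μ : SurfaceGroup g ≃* FundamentalGroup (centralSurface S) x₀),
      IsGroupTrisection g k (FundamentalGroup X (x₀ : X)) (groupTrisectionOf h x₀ μ) := by
  obtain ⟨x₀, ⟨μ⟩⟩ := hg X o g k S h
  exact ⟨x₀, μ, ha X o g k S h x₀ μ⟩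

end Literature.Topology.FourManifolds
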